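import Mathlib
import Literature.Analysis.Convexity.OpenHPolytopeContact
import HarnessLib

/-!
# Finite disjoint unions of open polytopes of `ℝ³`, I: splitting facet integrals, internal cancellation

Topic `Literature/Analysis/Convexity`; namespace `Literature.Analysis.Convexity`.  For a finite family
of pairwise disjoint open `H`-polytopes `Q_i` (data passed as functions with characterising hypotheses:
normal forms `J i`, sign-symmetric charts `Φ c`, open facets `oF i c`, nonempty cells `I`):
* `cell_normalForm` — a nonempty cell is the open polytope of its unit normal form;
* `setIntegral_openFacet_split` — a facet integral splits into the part away from the other cells and
  the (disjoint) facet-to-facet contact parts;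
* `sum_contact_integral_eq_zero` — **summed over all cells, the facet-to-facet contact integrals
  cancel** (`(i, c, j)` pairs with `(j, -c, i)` on the same chart domain with the opposite normal;
  `Finset.sum_involution`).
[cite: EvansGariepy2015, Thm 5.16 (Gauss–Green), polyhedral case; Maggi2012, Remark 20.3 p. 258]
-/

noncomputable section

namespace Literature.Analysis.Convexity

open _root_.MeasureTheory Set
open scoped RealInnerProductSpace Topology ENNReal
open Literature.MathematicalPhysics.StatisticalMechanics (fieldDivergence)
open Literature.MeasureTheory.Integral

/-! ### Finite disjoint unions of open polytopes: the cells, their normal forms and charts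

Throughout, the data of a finite family of open polytopes is passed as abstract functions with
characterising hypotheses (`hQ`, `hJ`, `hΦ`, `hoF`, `hI`), so that statements stay readable:
`Q i` the `i`-th open polytope, `J i` its unit normal form, `Φ c` the sign-symmetric isometric chart of
the plane of the constraint `c`, `oF i c` the open facet of `c` relative to `J i`, `I` the nonempty cells. -/

/-- Basic facts on a nonempty cell: it is the open polytope of its unit normal form, whose constraints
are unit and pairwise non-proportional, and its closure is the closed polyhedron of the normal form.
[cite: Rockafellar1970, §6 Thm 6.3 — plumbing] -/
theorem cell_normalForm {k : ℕ} (H : Fin k → Finset (EuclideanSpace ℝ (Fin 3) × ℝ))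
    (Q : Fin k → Set (EuclideanSpace ℝ (Fin 3)))
    (hQ : ∀ i, Q i = ⋂ p ∈ H i, {x : EuclideanSpace ℝ (Fin 3) | ⟪p.1, x⟫ < p.2})
    (J : Fin k → Finset (EuclideanSpace ℝ (Fin 3) × ℝ))
    (hJ : ∀ i, J i = ((H i).filter (fun p => p.1 ≠ 0)).image (fun p => (‖p.1‖⁻¹ • p.1, ‖p.1‖⁻¹ * p.2)))
    {i : Fin k} (hne : (Q i).Nonempty) :
    (Q i = ⋂ c ∈ J i, {x : EuclideanSpace ℝ (Fin 3) | ⟪c.1, x⟫ < c.2}) ∧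
    (∀ c ∈ J i, ‖c.1‖ = 1) ∧
    (∀ c ∈ J i, ∀ c' ∈ J i, c ≠ c' → ¬ ∃ μ : ℝ, c'.1 = μ • c.1 ∧ c'.2 = μ * c.2) ∧
    closure (Q i) = ⋂ c ∈ J i, {x : EuclideanSpace ℝ (Fin 3) | ⟪c.1, x⟫ ≤ c.2} := by
  have hne' : (⋂ p ∈ H i, {x : EuclideanSpace ℝ (Fin 3) | ⟪p.1, x⟫ < p.2}).Nonempty := by
    rw [← hQ i]; exact hne
  have h1 : Q i = ⋂ c ∈ J i, {x : EuclideanSpace ℝ (Fin 3) | ⟪c.1, x⟫ < c.2} := by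
    rw [hQ i, hJ i, openHPolytope_normalForm_eq (H i) hne']
  refine ⟨h1, fun c hc => norm_eq_one_of_mem_normalForm (H i) (by rw [← hJ i]; exact hc),
    fun c hc c' hc' hcc' => not_proportional_of_mem_normalForm (H i) hne' (by rw [← hJ i]; exact hc)
      (by rw [← hJ i]; exact hc') hcc', ?_⟩
  rw [h1]
  exact closure_openHPolytope_eq (J i) (by rw [← h1]; exact hne)

/-- A two-point evaluation of a finite sum all of whose other terms vanish.
[cite: EvansGariepy2015, Thm 5.16 (Gauss–Green) — plumbing] -/
theorem sum_eq_two_points {α : Type*} [DecidableEq α] (s : Finset α) (f : α → ℝ) {d d' : α}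
    (hdd' : d ≠ d') (h0 : ∀ c ∈ s, c ≠ d → c ≠ d' → f c = 0) :
    ∑ c ∈ s, f c = (if d ∈ s then f d else 0) + (if d' ∈ s then f d' else 0) := by
  have hsub : s.filter (fun c => c = d ∨ c = d') ⊆ s := Finset.filter_subset _ _
  rw [← Finset.sum_subset hsub (fun c hc hnc => by
    rw [Finset.mem_filter, not_and_or] at hnc
    rcases hnc with h | h
    · exact absurd hc h
    · push Not at h; exact h0 c hc h.1 h.2)]
  have hfilt : s.filter (fun c => c = d ∨ c = d') = ({d, d'} : Finset α).filter (fun c => c ∈ s) := by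
    ext c
    simp only [Finset.mem_filter, Finset.mem_insert, Finset.mem_singleton]
    tauto
  rw [hfilt, Finset.sum_filter, Finset.sum_pair hdd']

/-- **Splitting a facet integral of a cell** into the part away from the other cells and the
facet-to-facet contact parts (the contact with `closure (Q j)` is, up to a null set, the contact with
the open facet of `Q j` for the opposite constraint; the contact parts for different `j` are disjoint).
[cite: EvansGariepy2015, Thm 5.16 (Gauss–Green), polyhedral case — plumbing] -/
theorem setIntegral_openFacet_split {k : ℕ} (H : Fin k → Finset (EuclideanSpace ℝ (Fin 3) × ℝ))
    (Q : Fin k → Set (EuclideanSpace ℝ (Fin 3)))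
    (hQ : ∀ i, Q i = ⋂ p ∈ H i, {x : EuclideanSpace ℝ (Fin 3) | ⟪p.1, x⟫ < p.2})
    (J : Fin k → Finset (EuclideanSpace ℝ (Fin 3) × ℝ))
    (hJ : ∀ i, J i = ((H i).filter (fun p => p.1 ≠ 0)).image (fun p => (‖p.1‖⁻¹ • p.1, ‖p.1‖⁻¹ * p.2)))
    (fU fV : EuclideanSpace ℝ (Fin 3) → EuclideanSpace ℝ (Fin 3))
    (hfr : ∀ a, ‖a‖ = 1 → ‖fU a‖ = 1 ∧ ‖fV a‖ = 1 ∧ ⟪fU a, fV a⟫ = 0 ∧ ⟪a, fU a⟫ = 0 ∧ ⟪a, fV a⟫ = 0)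
    (Φ : EuclideanSpace ℝ (Fin 3) × ℝ → ℝ × ℝ → EuclideanSpace ℝ (Fin 3))
    (hΦ : ∀ c y, Φ c y = c.2 • c.1 + y.1 • fU c.1 + y.2 • fV c.1)
    (oF : Fin k → EuclideanSpace ℝ (Fin 3) × ℝ → Set (EuclideanSpace ℝ (Fin 3)))
    (hoF : ∀ i c, oF i c = {x | ⟪c.1, x⟫ = c.2 ∧ ∀ c' ∈ J i, c' ≠ c → ⟪c'.1, x⟫ < c'.2})
    (I : Finset (Fin k)) (hI : ∀ i, i ∈ I ↔ (Q i).Nonempty)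
    (hdisj : ∀ i j, i ≠ j → Disjoint (Q i) (Q j))
    {i : Fin k} (hi : i ∈ I) {c : EuclideanSpace ℝ (Fin 3) × ℝ} (hc : c ∈ J i)
    {g : ℝ × ℝ → ℝ} (hg : Integrable g volume) :
    ∫ y in Φ c ⁻¹' oF i c, g y =
      (∫ y in Φ c ⁻¹' (oF i c \ ⋃ j ∈ I.erase i, closure (Q j)), g y) +
        ∑ j ∈ I.erase i, ∫ y in Φ c ⁻¹' (oF i c ∩ oF j (-c.1, -c.2)), g y := by
  classical
  obtain ⟨hQi, h1i, hndi, hcli⟩ := cell_normalForm H Q hQ J hJ ((hI i).1 hi)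
  obtain ⟨hU1, hV1, hUV, haU, haV⟩ := hfr c.1 (h1i c hc)
  have hΦc : (Φ c) = fun y : ℝ × ℝ => c.2 • c.1 + y.1 • fU c.1 + y.2 • fV c.1 := funext (hΦ c)
  have hΦcont : Continuous (Φ c) := by rw [hΦc]; fun_prop
  have hmeas_oF : ∀ j e, MeasurableSet (oF j e) := fun j e => by
    rw [hoF]; exact measurableSet_openFacet (J j) e
  -- the two pieces
  set W : Set (EuclideanSpace ℝ (Fin 3)) := ⋃ j ∈ I.erase i, closure (Q j) with hW
  have hWc : IsClosed W := isClosed_biUnion_finset fun j _ => isClosed_closure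
  have hsplit : Φ c ⁻¹' oF i c = Φ c ⁻¹' (oF i c \ W) ∪ Φ c ⁻¹' (oF i c ∩ W) := by
    rw [← Set.preimage_union, Set.sdiff_union_inter]
  have hdisjDG : Disjoint (Φ c ⁻¹' (oF i c \ W)) (Φ c ⁻¹' (oF i c ∩ W)) :=
    Disjoint.preimage _ (Set.disjoint_left.2 fun x hx hx' => hx.2 hx'.2)
  rw [hsplit, setIntegral_union hdisjDG (((hmeas_oF i c).inter hWc.measurableSet).preimage
    hΦcont.measurable) hg.integrableOn hg.integrableOn]
  congr 1
  -- the contact part: `Φ⁻¹(oF ∩ W)` agrees a.e. with the disjoint union of the facet-to-facet contacts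
  have hZsub : ∀ j ∈ I.erase i, Φ c ⁻¹' (oF i c ∩ oF j (-c.1, -c.2)) ⊆ Φ c ⁻¹' (oF i c ∩ W) := by
    intro j hj y hy
    refine ⟨hy.1, Set.mem_biUnion hj ?_⟩
    have hjI : j ∈ I := (Finset.mem_erase.1 hj).2
    obtain ⟨hQj, -, -, hclj⟩ := cell_normalForm H Q hQ J hJ ((hI j).1 hjI)
    rw [hclj]
    have : Φ c y ∈ oF j (-c.1, -c.2) := hy.2
    rw [hoF] at this
    exact openFacet_subset_closedHPolytope (J j) this
  have hae : (Φ c ⁻¹' (oF i c ∩ W) : Set (ℝ × ℝ)) =ᵐ[volume]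
      (⋃ j ∈ I.erase i, Φ c ⁻¹' (oF i c ∩ oF j (-c.1, -c.2)) : Set (ℝ × ℝ)) := by
    refine (ae_eq_set).2 ⟨?_, ?_⟩
    · -- covered by the null differences, cell by cell
      have hcov : Φ c ⁻¹' (oF i c ∩ W) \ (⋃ j ∈ I.erase i, Φ c ⁻¹' (oF i c ∩ oF j (-c.1, -c.2))) ⊆
          ⋃ j ∈ I.erase i, (Φ c ⁻¹' (oF i c ∩ closure (Q j)) \
            Φ c ⁻¹' (oF i c ∩ oF j (-c.1, -c.2))) := by
        intro y hy
        obtain ⟨⟨hyF, hyW⟩, hyn⟩ := hy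
        rw [hW, Set.mem_iUnion₂] at hyW
        obtain ⟨j, hj, hyj⟩ := hyW
        refine Set.mem_biUnion hj ⟨⟨hyF, hyj⟩, fun h => hyn (Set.mem_biUnion hj h)⟩
      refine measure_mono_null hcov ((measure_biUnion_null_iff (I.erase i).countable_toSet).2
        fun j hj => ?_)
      have hjI : j ∈ I := (Finset.mem_erase.1 hj).2
      have hji : j ≠ i := (Finset.mem_erase.1 hj).1
      obtain ⟨hQj, h1j, -, -⟩ := cell_normalForm H Q hQ J hJ ((hI j).1 hjI)
      have := volume_contact_diff_eq_zero (J i) (J j) h1i h1j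
        (by rw [← hQi]; exact (hI i).1 hi) (by rw [← hQj]; exact (hI j).1 hjI)
        (by rw [← hQi, ← hQj]; exact hdisj i j (Ne.symm hji)) hc (fU c.1) (fV c.1) hU1 hV1 hUV haU haV
      rw [hΦc, hoF, hoF, hQj]
      exact this
    · rw [Set.sdiff_eq_empty.2 (Set.iUnion₂_subset hZsub), measure_empty]
  rw [setIntegral_congr_set hae]
  refine integral_biUnion_finset _ (fun j _ => ((hmeas_oF i c).inter (hmeas_oF j _)).preimage
    hΦcont.measurable) ?_ (fun j _ => hg.integrableOn)
  -- pairwise disjointness of the facet-to-facet contacts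
  intro j hj j' hj' hjj'
  have hjI : j ∈ I := (Finset.mem_erase.1 (Finset.mem_coe.1 hj)).2
  have hj'I : j' ∈ I := (Finset.mem_erase.1 (Finset.mem_coe.1 hj')).2
  obtain ⟨hQj, -, -, -⟩ := cell_normalForm H Q hQ J hJ ((hI j).1 hjI)
  obtain ⟨hQj', -, -, -⟩ := cell_normalForm H Q hQ J hJ ((hI j').1 hj'I)
  have hc0 : ((-c.1, -c.2) : EuclideanSpace ℝ (Fin 3) × ℝ).1 ≠ 0 := by
    show -c.1 ≠ 0
    rw [neg_ne_zero]; intro h; have := h1i c hc; rw [h, norm_zero] at this; exact zero_ne_one this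
  have hd := disjoint_openFacet_of_disjoint (J j) (J j') (-c.1, -c.2) hc0
    (by rw [← hQj, ← hQj']; exact hdisj j j' hjj')
  refine Disjoint.preimage _ ?_
  rw [hoF j, hoF j']
  exact Disjoint.mono Set.inter_subset_right Set.inter_subset_right hd


/-- The sign-symmetric chart does not see the orientation of the constraint: `Φ (-c.1, -c.2) = Φ c`.
[cite: EvansGariepy2015, Thm 5.16 (Gauss–Green) — plumbing] -/
theorem chart_neg_eq (fU fV : EuclideanSpace ℝ (Fin 3) → EuclideanSpace ℝ (Fin 3))
    (hsym : ∀ a, fU (-a) = fU a ∧ fV (-a) = fV a)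
    (Φ : EuclideanSpace ℝ (Fin 3) × ℝ → ℝ × ℝ → EuclideanSpace ℝ (Fin 3))
    (hΦ : ∀ c y, Φ c y = c.2 • c.1 + y.1 • fU c.1 + y.2 • fV c.1) (c : EuclideanSpace ℝ (Fin 3) × ℝ) :
    Φ (-c.1, -c.2) = Φ c := by
  funext y
  rw [hΦ, hΦ]
  simp only [neg_smul_neg, (hsym c.1).1, (hsym c.1).2]

/-- **Internal facets cancel.**  Summed over all cells `i`, all constraints `c` of `i` and all other
cells `j`, the facet-to-facet contact integrals `∫_{Φ_c⁻¹(oF_i(c) ∩ oF_j(-c))} ⟪η∘Φ_c, c.1⟫` vanish: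
the term `(i, c, j)` is paired with `(j, -c, i)`, which carries the opposite normal on the same chart
domain (and a term whose partner constraint `-c ∉ J j` is itself zero).
[cite: EvansGariepy2015, Thm 5.16 (Gauss–Green), polyhedral case; Maggi2012, Remark 20.3 p. 258] -/
theorem sum_contact_integral_eq_zero {k : ℕ} (H : Fin k → Finset (EuclideanSpace ℝ (Fin 3) × ℝ))
    (Q : Fin k → Set (EuclideanSpace ℝ (Fin 3)))
    (hQ : ∀ i, Q i = ⋂ p ∈ H i, {x : EuclideanSpace ℝ (Fin 3) | ⟪p.1, x⟫ < p.2})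
    (J : Fin k → Finset (EuclideanSpace ℝ (Fin 3) × ℝ))
    (hJ : ∀ i, J i = ((H i).filter (fun p => p.1 ≠ 0)).image (fun p => (‖p.1‖⁻¹ • p.1, ‖p.1‖⁻¹ * p.2)))
    (fU fV : EuclideanSpace ℝ (Fin 3) → EuclideanSpace ℝ (Fin 3))
    (hsym : ∀ a, fU (-a) = fU a ∧ fV (-a) = fV a)
    (Φ : EuclideanSpace ℝ (Fin 3) × ℝ → ℝ × ℝ → EuclideanSpace ℝ (Fin 3))
    (hΦ : ∀ c y, Φ c y = c.2 • c.1 + y.1 • fU c.1 + y.2 • fV c.1)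
    (oF : Fin k → EuclideanSpace ℝ (Fin 3) × ℝ → Set (EuclideanSpace ℝ (Fin 3)))
    (hoF : ∀ i c, oF i c = {x | ⟪c.1, x⟫ = c.2 ∧ ∀ c' ∈ J i, c' ≠ c → ⟪c'.1, x⟫ < c'.2})
    (I : Finset (Fin k)) (hI : ∀ i, i ∈ I ↔ (Q i).Nonempty)
    (hdisj : ∀ i j, i ≠ j → Disjoint (Q i) (Q j))
    (η : EuclideanSpace ℝ (Fin 3) → EuclideanSpace ℝ (Fin 3)) :
    ∑ i ∈ I, ∑ c ∈ J i, ∑ j ∈ I.erase i,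
      ∫ y in Φ c ⁻¹' (oF i c ∩ oF j (-c.1, -c.2)), ⟪η (Φ c y), c.1⟫ = 0 := by
  classical
  -- as one sum over the index finset of triples
  set T : (Σ _ : Fin k, (EuclideanSpace ℝ (Fin 3) × ℝ) × Fin k) → ℝ := fun x =>
    ∫ y in Φ x.2.1 ⁻¹' (oF x.1 x.2.1 ∩ oF x.2.2 (-x.2.1.1, -x.2.1.2)), ⟪η (Φ x.2.1 y), x.2.1.1⟫ with hT
  have hsum : ∑ i ∈ I, ∑ c ∈ J i, ∑ j ∈ I.erase i,
      ∫ y in Φ c ⁻¹' (oF i c ∩ oF j (-c.1, -c.2)), ⟪η (Φ c y), c.1⟫ =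
      ∑ x ∈ I.sigma (fun i => J i ×ˢ I.erase i), T x := by
    rw [Finset.sum_sigma]
    refine Finset.sum_congr rfl fun i _ => ?_
    rw [Finset.sum_product]
  rw [hsum]
  -- vanishing of the unmatched terms
  have hzero : ∀ i ∈ I, ∀ c ∈ J i, ∀ j ∈ I, j ≠ i → ((-c.1, -c.2) : EuclideanSpace ℝ (Fin 3) × ℝ) ∉ J j →
      Φ c ⁻¹' (oF i c ∩ oF j (-c.1, -c.2)) = ∅ := by
    intro i hi c hc j hj hji hnot
    obtain ⟨hQi, -, -, hcli⟩ := cell_normalForm H Q hQ J hJ ((hI i).1 hi)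
    obtain ⟨hQj, -, -, -⟩ := cell_normalForm H Q hQ J hJ ((hI j).1 hj)
    have h1 : oF j (-c.1, -c.2) ⊆ Q j := by
      rw [hoF, hQj]; exact openFacet_subset_openHPolytope_of_not_mem (J j) hnot
    have h2 : oF i c ⊆ closure (Q i) := by
      rw [hoF, hcli]; exact openFacet_subset_closedHPolytope (J i)
    have hQjo : IsOpen (Q j) := by rw [hQ]; exact isOpen_openHPolytope (H j)
    have hd : Disjoint (Q j) (closure (Q i)) := (hdisj j i hji).closure_right hQjo
    rw [Set.eq_empty_iff_forall_notMem]
    intro y hy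
    exact Set.disjoint_left.1 hd (h1 hy.2) (h2 hy.1)
  refine Finset.sum_involution
    (fun x _ => if ((-x.2.1.1, -x.2.1.2) : EuclideanSpace ℝ (Fin 3) × ℝ) ∈ J x.2.2 then
      ⟨x.2.2, ((-x.2.1.1, -x.2.1.2), x.1)⟩ else x) ?_ ?_ ?_ ?_
  · -- `T x + T (g x) = 0`
    rintro ⟨i, c, j⟩ hx
    obtain ⟨hi, hcj⟩ := Finset.mem_sigma.1 hx
    obtain ⟨hc, hj⟩ := Finset.mem_product.1 hcj
    dsimp only at hi hc hj
    obtain ⟨hji, hjI⟩ := Finset.mem_erase.1 hj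
    by_cases hmem : ((-c.1, -c.2) : EuclideanSpace ℝ (Fin 3) × ℝ) ∈ J j
    · have hΦneg : Φ (-c.1, -c.2) = Φ c := chart_neg_eq fU fV hsym Φ hΦ c
      have hset : oF j (-c.1, -c.2) ∩ oF i (-(-c.1), -(-c.2)) = oF i c ∩ oF j (-c.1, -c.2) := by
        rw [Set.inter_comm, neg_neg, neg_neg]
      have hneg : (fun y : ℝ × ℝ => ⟪η (Φ c y), -c.1⟫) = fun y => -⟪η (Φ c y), c.1⟫ := by
        funext y; rw [inner_neg_right]
      simp only [hmem, if_true, hT, hΦneg, hset, hneg, integral_neg, add_neg_cancel]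
    · simp only [hmem, if_false, hT, hzero i hi c hc j hjI hji hmem, Measure.restrict_empty,
        integral_zero_measure, add_zero]
  · -- moved when nonzero
    rintro ⟨i, c, j⟩ hx hne
    obtain ⟨hi, hcj⟩ := Finset.mem_sigma.1 hx
    obtain ⟨hc, hj⟩ := Finset.mem_product.1 hcj
    dsimp only at hi hc hj hne
    obtain ⟨hji, hjI⟩ := Finset.mem_erase.1 hj
    by_cases hmem : ((-c.1, -c.2) : EuclideanSpace ℝ (Fin 3) × ℝ) ∈ J j
    · simp only [hmem, if_true]
      intro h
      have := congrArg Sigma.fst h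
      exact hji this
    · exfalso; apply hne
      simp only [hT, hzero i hi c hc j hjI hji hmem, Measure.restrict_empty, integral_zero_measure]
  · -- stays in the index set
    rintro ⟨i, c, j⟩ hx
    obtain ⟨hi, hcj⟩ := Finset.mem_sigma.1 hx
    obtain ⟨hc, hj⟩ := Finset.mem_product.1 hcj
    dsimp only at hi hc hj
    obtain ⟨hji, hjI⟩ := Finset.mem_erase.1 hj
    by_cases hmem : ((-c.1, -c.2) : EuclideanSpace ℝ (Fin 3) × ℝ) ∈ J j
    · simp only [hmem, if_true]
      exact Finset.mem_sigma.2 ⟨hjI, Finset.mem_product.2 ⟨hmem, Finset.mem_erase.2 ⟨Ne.symm hji, hi⟩⟩⟩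
    · simp only [hmem, if_false]; exact hx
  · -- involutive
    rintro ⟨i, c, j⟩ hx
    obtain ⟨hi, hcj⟩ := Finset.mem_sigma.1 hx
    obtain ⟨hc, hj⟩ := Finset.mem_product.1 hcj
    dsimp only at hi hc hj
    by_cases hmem : ((-c.1, -c.2) : EuclideanSpace ℝ (Fin 3) × ℝ) ∈ J j
    · simp [hmem, hc]
    · simp [hmem]


end Literature.Analysis.Convexity

end
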